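import Mathlib.Analysis.SpecialFunctions.Log.Basic
import Mathlib.Data.NNReal.Basic
import Mathlib.Algebra.Order.Monoid.Unbundled.Pow
import Mathlib.Algebra.Category.MonCat.Basic
import Mathlib.CategoryTheory.Functor.Const
import Literature.AlgebraicGeometry.Frobenioids.ElementaryFrobenioid
import Literature.AlgebraicGeometry.Frobenioids.ArchimedeanFrobenioids
import HarnessLib

/-!
# Frobenioids II, Example 3.3 (i): `Div`, `Φ₀` and the pre-Frobenioid structure `C₀ → F_{Φ₀}`

Mochizuki, *The geometry of Frobenioids II: poly-Frobenioids*, Kyushu J. Math. **62** (2008)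
401–460, §3, Example 3.3 (i), author's text p. 28 [cite: MochizukiFrdII2008, Ex 3.3 (i) p.28]:
"we shall write `Div(φ) := log(λ) ∈ ℝ_{≥0}`, for the largest `λ ∈ ℝ_{>0}` such that
`λ · Im(A_L^{⊗d}) ⊆ A_K|_L`. If we denote by `Φ₀ : D₀ → Mon` the functor determined by the assignment
`Spec(K) ↦ ord(K) ≅ ℝ_{>0} ≅ ℝ_{≥0}` [where the isomorphism `ℝ_{>0} ⥲ ℝ_{≥0}` is given by the
natural logarithm], then the triple `(Base(−), Div(−), deg_Fr(−))` determines a pre-Frobenioid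
structure `C₀ → F_{Φ₀}` on `C₀`." Also (p. 28 l. 1): "One verifies immediately that this category
`C₀` is connected and totally epimorphic."

Rendering as in `ArchimedeanFrobenioids.lean` (`V_K := K` inside `ℂ`): for
`φ = (Base, d, c) : (L, A_L) → (K, A_K)` the largest such `λ` is `tip(A_K) / (|c| · tip(A_L)^d)`
(`C0.ratio φ`), and `Div(φ) = log(ratio φ)` in the tree's monoid `Multiplicative ℝ≥0`
(cf. `IsRMonoprime`, `Monoids.lean`).

**Contents / claims.** `ratio ≥ 1` PROVED (condition (c) at a boundary point); `Div(id) = 0` and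
the composite law `Div(ψ ≫ φ) = Base(ψ)^* Div(φ) + deg_Fr(φ) · Div(ψ)` PROVED (`div_comp`), so that
`(Base, Div, deg_Fr)` IS a functor `C0.toElem : C0 ⥤ F_{Φ₀}` into found's elementary Frobenioid;
"`C₀` is connected and totally epimorphic" PROVED (`C0.isConnectedStatement_holds`,
`C0.isTotallyEpimorphic`); `ℝ_{≥0}` is a divisorial monoid and `Φ₀` a monoid on `D₀` PROVED
(`isDivisorial_nnreal`, `isMonoidOn_Φ₀`); hence **"`(Base, Div, deg_Fr)` determines a pre-Frobenioid
structure `C₀ → F_{Φ₀}`" in the sense of [FrdI] Def. 1.1 (iv) is PROVED**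
(`C0.preFrobenioidStructure_holds : IsPreFrobenioid Φ₀ C0.toElem`). Named statement (not proved
here): the "largest `λ`" description of `Div` (`C0.DivIsLogLargest`). Deliberately NOT here:
`C := C₀ ×_{D₀} D` and Example 3.3 (ii)–(v) (`AngularFrobenioids*.lean`).
-/

namespace Literature.AlgebraicGeometry.Frobenioids

open CategoryTheory Opposite
open scoped Pointwise NNReal

noncomputable section

namespace ArchFrd

namespace C0

variable {X Y Z : C0}

/-! ### `Div` -/

/-- The ratio `tip(A_K) / (|c| · tip(A_L)^d)` of `φ = (Base, d, c) : (L, A_L) → (K, A_K)`: the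
largest `λ` with `λ · Im(A_L^{⊗d}) ⊆ A_K|_L` (FrdII Ex. 3.3 (i), p. 28).
[cite: MochizukiFrdII2008, Ex 3.3 (i) p.28] -/
def ratio (φ : X ⟶ Y) : ℝ := Y.tip / (‖(scalar φ : ℂ)‖ * X.tip ^ (degFr φ : ℕ))

/-- Every angular region has a boundary point (its angular part is nonempty).
[cite: MochizukiFrdII2008, Def 3.1 (iii) p.24] -/
theorem exists_mem_boundary (A : AngularRegion ℂ) : ∃ a, a ∈ A.boundary := by
  obtain ⟨z, hz, -⟩ := (A.isConnected_inter 1).nonempty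
  obtain ⟨a, ha, -⟩ := A.bijOn_unitPart_boundary.surjOn hz
  exact ⟨a, ha⟩

/-- The condition (c) forces `|c| · tip(A_L)^d ≤ tip(A_K)` (evaluate at a boundary point).
[cite: MochizukiFrdII2008, Ex 3.3 (i) p.28] -/
theorem norm_scalar_mul_tip_pow_le (φ : X ⟶ Y) :
    ‖(scalar φ : ℂ)‖ * X.tip ^ (degFr φ : ℕ) ≤ Y.tip := by
  obtain ⟨a, ha, habs⟩ := exists_mem_boundary X.region
  have hmem : scalar φ • a ^ (degFr φ : ℕ) ∈ pullRegion Y (Base φ) :=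
    φ.mapsTo (Set.smul_mem_smul_set (Set.pow_mem_pow ha))
  obtain ⟨y, hy, hyeq⟩ := hmem
  have hyle : (absHom ℂ y : ℝ) ≤ Y.tip := hy.2
  have ha' : ‖(a : ℂ)‖ = X.tip := by rw [← coe_absHom, habs]; rfl
  calc ‖(scalar φ : ℂ)‖ * X.tip ^ (degFr φ : ℕ)
      = ‖((scalar φ • a ^ (degFr φ : ℕ) : ℂˣ) : ℂ)‖ := by
        rw [smul_eq_mul, Units.val_mul, norm_mul, Units.val_pow_eq_pow_val, norm_pow, ha']
    _ = ‖(((Base φ).act y : ℂˣ) : ℂ)‖ := by rw [hyeq]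
    _ = (absHom ℂ y : ℝ) := by rw [coe_absHom]; exact D0.norm_galAct _ _
    _ ≤ Y.tip := hyle

/-- `1 ≤ tip(A_K) / (|c| · tip(A_L)^d)`, i.e. `Div(φ) = log(ratio) ≥ 0`.
[cite: MochizukiFrdII2008, Ex 3.3 (i) p.28] -/
theorem one_le_ratio (φ : X ⟶ Y) : 1 ≤ ratio φ := by
  have hpos : 0 < ‖(scalar φ : ℂ)‖ * X.tip ^ (degFr φ : ℕ) :=
    mul_pos (norm_pos_iff.mpr (scalar φ).ne_zero) (pow_pos X.tip_pos _)
  exact (one_le_div hpos).mpr (norm_scalar_mul_tip_pow_le φ)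

/-- The ratio is positive. [cite: MochizukiFrdII2008, Ex 3.3 (i) p.28] -/
theorem ratio_pos (φ : X ⟶ Y) : 0 < ratio φ := lt_of_lt_of_le one_pos (one_le_ratio φ)

/-- "`Div(φ) := log(λ) ∈ ℝ_{≥0}`, for the largest `λ ∈ ℝ_{>0}` such that `λ · Im(A_L^{⊗d}) ⊆ A_K|_L`"
(FrdII Ex. 3.3 (i), p. 28), in the tree's monoid `Multiplicative ℝ≥0`.
[cite: MochizukiFrdII2008, Ex 3.3 (i) p.28] -/
def div (φ : X ⟶ Y) : Multiplicative ℝ≥0 :=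
  Multiplicative.ofAdd ⟨Real.log (ratio φ), Real.log_nonneg (one_le_ratio φ)⟩

/-- `Div(φ)` as a real number is `log(ratio φ)`. [cite: MochizukiFrdII2008, Ex 3.3 (i) p.28] -/
@[simp] theorem coe_toAdd_div (φ : X ⟶ Y) :
    ((Multiplicative.toAdd (div φ) : ℝ≥0) : ℝ) = Real.log (ratio φ) := rfl

/-- `Div(id) = 0`. [cite: MochizukiFrdII2008, Ex 3.3 (i) p.28] -/
theorem ratio_id (X : C0) : ratio (𝟙 X) = 1 := by
  unfold ratio
  rw [scalar_id', degFr_id', Units.val_one, norm_one, one_mul, PNat.one_coe, pow_one,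
    div_self X.tip_pos.ne']

/-- `Div(id) = 0`. [cite: MochizukiFrdII2008, Ex 3.3 (i) p.28] -/
@[simp] theorem div_id (X : C0) : div (𝟙 X) = 1 := by
  apply Multiplicative.toAdd.injective
  apply NNReal.eq
  rw [coe_toAdd_div, ratio_id, Real.log_one]
  rfl

/-- The ratio of a composite: `ratio(ψ ≫ φ) = ratio(φ) · ratio(ψ)^{deg_Fr(φ)}`.
[cite: MochizukiFrdII2008, Ex 3.3 (i) p.28] -/
theorem ratio_comp (ψ : X ⟶ Y) (φ : Y ⟶ Z) :
    ratio (ψ ≫ φ) = ratio φ * ratio ψ ^ (degFr φ : ℕ) := by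
  unfold ratio
  have hX := X.tip_pos
  have hY := Y.tip_pos
  have hψ : 0 < ‖(scalar ψ : ℂ)‖ := norm_pos_iff.mpr (scalar ψ).ne_zero
  have hφ : 0 < ‖(scalar φ : ℂ)‖ := norm_pos_iff.mpr (scalar φ).ne_zero
  rw [scalar_comp', degFr_comp', Units.val_mul, norm_mul, Units.val_pow_eq_pow_val, norm_pow,
    D0.norm_galAct, PNat.mul_coe, pow_mul, div_pow, mul_pow]
  field_simp

/-- **The composite law of `Div`** (FrdII Ex. 3.3 (i), p. 28; [FrdI] Def. 1.1 (iii)):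
`Div(ψ ≫ φ) = Base(ψ)^* Div(φ) + deg_Fr(φ) · Div(ψ)` with trivial pull-backs — PROVED
(multiplicative rendering). [cite: MochizukiFrdII2008, Ex 3.3 (i) p.28] -/
theorem div_comp (ψ : X ⟶ Y) (φ : Y ⟶ Z) : div (ψ ≫ φ) = div φ * div ψ ^ (degFr φ : ℕ) := by
  apply Multiplicative.toAdd.injective
  apply NNReal.eq
  rw [toAdd_mul, toAdd_pow, NNReal.coe_add, NNReal.coe_nsmul, coe_toAdd_div, coe_toAdd_div,
    coe_toAdd_div, ratio_comp, Real.log_mul (ratio_pos φ).ne' (pow_pos (ratio_pos ψ) _).ne',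
    Real.log_pow, nsmul_eq_mul]

/-! ### `Φ₀` and the pre-Frobenioid structure `C₀ → F_{Φ₀}` -/

end C0

/-- "`Φ₀ : D₀ → Mon`, the functor determined by the assignment `Spec(K) ↦ ord(K) ≅ ℝ_{>0} ≅ ℝ_{≥0}`
[where the isomorphism `ℝ_{>0} ⥲ ℝ_{≥0}` is given by the natural logarithm]" (FrdII Ex. 3.3 (i),
p. 28): the constant monoid `ℝ_{≥0}` on `D₀` (all pull-back maps are the identity, as `ord(ℝ^×) →
ord(ℂ^×)` is). [cite: MochizukiFrdII2008, Ex 3.3 (i) p.28] -/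
def Φ₀ : D0ᵒᵖ ⥤ CommMonCat.{0} :=
  (Functor.const _).obj (CommMonCat.of (Multiplicative ℝ≥0))

/-- The pull-back maps of `Φ₀` are identities. [cite: MochizukiFrdII2008, Ex 3.3 (i) p.28] -/
@[simp] theorem pull_Φ₀ {L K : D0} (f : L ⟶ K) (x : Multiplicative ℝ≥0) :
    pull Φ₀ f x = x := rfl

/-! ### `ℝ_{≥0}` is divisorial; `Φ₀` is a divisorial monoid on `D₀` -/

/-- `ℝ_{≥0}` is sharp (no nontrivial units). [cite: MochizukiFrdI2008, §0 p.11] -/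
theorem isSharp_nnreal : IsSharp (Multiplicative ℝ≥0) := by
  refine ⟨fun a ha => ?_⟩
  obtain ⟨u, rfl⟩ := ha
  have h : Multiplicative.toAdd (u : Multiplicative ℝ≥0) +
      Multiplicative.toAdd ((u⁻¹ : (Multiplicative ℝ≥0)ˣ) : Multiplicative ℝ≥0) = 0 := by
    rw [← toAdd_mul, Units.mul_inv, toAdd_one]
  exact Multiplicative.toAdd.injective (add_eq_zero.mp h).1

/-- `ℝ_{≥0}` is of characteristic type (its only unit is `0`). [cite: MochizukiFrdI2008, §0 p.11] -/
theorem isOfCharType_nnreal : IsOfCharType (Multiplicative ℝ≥0) :=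
  ⟨fun u _ _ => Units.ext (isSharp_nnreal.1 (u : Multiplicative ℝ≥0) u.isUnit)⟩

/-- `ℝ_{≥0}` is integral (cancellative). [cite: MochizukiFrdI2008, §0 p.11] -/
theorem isIntegral_nnreal : IsIntegral (Multiplicative ℝ≥0) :=
  ⟨Algebra.GrothendieckGroup.of_injective⟩

/-- `ℝ_{≥0}` is saturated: if `n · x` (`x ∈ ℝ = (ℝ_{≥0})^gp`, `n ≥ 1`) is `≥ 0` then `x ≥ 0`.
[cite: MochizukiFrdI2008, §0 p.11] -/
theorem isSaturated_nnreal : IsSaturated (Multiplicative ℝ≥0) := by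
  refine ⟨fun x n hn ⟨c, hc⟩ => ?_⟩
  obtain ⟨⟨a, b⟩, h⟩ := (Localization.monoidOf (⊤ : Submonoid (Multiplicative ℝ≥0))).surj x
  -- `x * of b = of a`, so `of (a ^ n) = of (c * b ^ n)` and `a ^ n = c * b ^ n`
  have hb : x = Algebra.GrothendieckGroup.of a / Algebra.GrothendieckGroup.of (b : Multiplicative ℝ≥0) :=
    eq_div_iff_mul_eq'.mpr h
  have hab : a ^ n = c * (b : Multiplicative ℝ≥0) ^ n := by
    apply Algebra.GrothendieckGroup.of_injective
    rw [map_mul, map_pow, map_pow, hc, hb, div_pow, div_mul_cancel]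
  -- additively: `n • a = c + n • b`, hence `b ≤ a`
  have hle : Multiplicative.toAdd (b : Multiplicative ℝ≥0) ≤ Multiplicative.toAdd a := by
    have h' : n • Multiplicative.toAdd a = Multiplicative.toAdd c + n • Multiplicative.toAdd (b : Multiplicative ℝ≥0) := by
      rw [← toAdd_pow, hab, toAdd_mul, toAdd_pow]
    have h'' : n • Multiplicative.toAdd (b : Multiplicative ℝ≥0) ≤ n • Multiplicative.toAdd a := by
      rw [h']; exact le_add_self
    exact le_of_nsmul_le_nsmul_right hn.ne' h''
  obtain ⟨d, hd⟩ := exists_add_of_le hle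
  refine ⟨Multiplicative.ofAdd d, ?_⟩
  rw [hb, eq_div_iff_mul_eq', ← map_mul]
  congr 1
  apply Multiplicative.toAdd.injective
  rw [toAdd_mul, toAdd_ofAdd, hd, add_comm]

/-- **`ℝ_{≥0}` is a divisorial monoid** ([FrdI] Def. 1.1 (i): integral, saturated, of characteristic
type, sharp) — PROVED; it is the divisor monoid `Φ₀(Spec K)` of FrdII Ex. 3.3 (i).
[cite: MochizukiFrdII2008, Ex 3.3 (i) p.28] -/
theorem isDivisorial_nnreal : IsDivisorial (Multiplicative ℝ≥0) where
  isPreDivisorial :=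
    { isIntegral := isIntegral_nnreal
      isSaturated := isSaturated_nnreal
      isOfCharType := isOfCharType_nnreal }
  isSharp := isSharp_nnreal

/-- `Φ₀` is a monoid on `D₀` ([FrdI] Def. 1.1 (ii)): its pull-back maps are identities — PROVED.
[cite: MochizukiFrdII2008, Ex 3.3 (i) p.28] -/
theorem isMonoidOn_Φ₀ : IsMonoidOn Φ₀ := by
  refine ⟨fun f => ⟨fun x y h => h, fun x y h => ?_⟩, fun f _ => ⟨fun x y h => h, fun y => ⟨y, rfl⟩⟩⟩
  obtain ⟨a, rfl⟩ := Associates.mk_surjective x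
  obtain ⟨b, rfl⟩ := Associates.mk_surjective y
  exact h

/-- `Φ₀` is (objectwise) divisorial — PROVED. [cite: MochizukiFrdII2008, Ex 3.3 (i) p.28] -/
theorem isDivisorial_Φ₀ : Objectwise (fun M _ => IsDivisorial M) Φ₀ := fun _ => isDivisorial_nnreal

/-- The unique arrow `K ⟶ Spec ℝ` of `D₀`. [cite: MochizukiFrdII2008, §3 p.23] -/
def D0.homToReal : (K : D0) → (K ⟶ D0.real)
  | .real => 𝟙 _
  | .complex => D0.toRealHom

/-- A positive real scalar lies in `K^×` for every `K`. [cite: MochizukiFrdII2008, Def 3.1 (ii) p.23] -/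
theorem ofPosReal_mem_scalars (t : PosReal) (K : D0) : ofPosReal ℂ t ∈ D0.scalars K := by
  cases K
  · rw [D0.mem_scalars_real_iff, coe_ofPosReal]
    exact Complex.ofReal_im _
  · exact Subgroup.mem_top _

namespace C0

variable {X Y Z : C0}

/-- The real object of `C₀` with tip `t`: `(Spec ℝ, ℝ, [-t, t] ∖ {0})`, recorded by its isotropic
complexification. [cite: MochizukiFrdII2008, Ex 3.3 (i) p.27] -/
def realOfTip (t : PosReal) : C0 where
  base := .real
  region := AngularRegion.isotropicOfTip t
  isIsotropic_of_isReal _ := AngularRegion.isIsotropic_isotropicOfTip t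

/-- The arrow `X → (Spec ℝ, ℝ, [-1, 1] ∖ {0})` rescaling by `1 / tip(A_X)` (used for connectedness).
[cite: MochizukiFrdII2008, Ex 3.3 (i) p.28] -/
def toRealUnit (X : C0) : X ⟶ realOfTip 1 where
  base := D0.homToReal X.base
  degFr := 1
  scalar := ofPosReal ℂ ⟨1 / X.tip, div_pos one_pos X.tip_pos⟩
  scalar_mem := ofPosReal_mem_scalars _ _
  mapsTo := by
    rw [PNat.one_coe, pow_one]
    have hiso : (realOfTip 1).region.IsIsotropic := AngularRegion.isIsotropic_isotropicOfTip 1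
    change _ ⊆ (D0.homToReal X.base).act '' (realOfTip 1).region.carrier
    unfold D0.Hom.act
    rw [image_galAct_of_isIsotropic hiso]
    rintro _ ⟨u, hu, rfl⟩
    rw [mem_carrier_of_isIsotropic hiso, ← Subtype.coe_le_coe, coe_absHom]
    change ‖((ofPosReal ℂ ⟨1 / X.tip, _⟩ * u : ℂˣ) : ℂ)‖ ≤ (1 : ℝ)
    have hu' : ‖(u : ℂ)‖ ≤ X.tip := by
      have := hu.2
      rw [← Subtype.coe_le_coe, coe_absHom] at this
      exact this
    rw [Units.val_mul, norm_mul, coe_ofPosReal, RCLike.norm_ofReal,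
      abs_of_pos (div_pos one_pos X.tip_pos)]
    calc 1 / X.tip * ‖(u : ℂ)‖ ≤ 1 / X.tip * X.tip := by
          gcongr; exact (div_pos one_pos X.tip_pos).le
      _ = 1 := div_mul_cancel₀ _ X.tip_pos.ne'

/-- "the triple `(Base(−), Div(−), deg_Fr(−))` determines a pre-Frobenioid structure `C₀ → F_{Φ₀}`
on `C₀`" (FrdII Ex. 3.3 (i), p. 28): the functor to found's elementary Frobenioid `F_{Φ₀}` — DATA,
functoriality PROVED (`div_id`, `div_comp`). [cite: MochizukiFrdII2008, Ex 3.3 (i) p.28] -/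
def toElem : C0 ⥤ ElemFrobenioid Φ₀ where
  obj X := ElemFrobenioid.of Φ₀ X.base
  map φ := ElemFrobenioid.homMk (Base φ) (div φ) (degFr φ)
  map_id X := by
    refine ElemFrobenioid.Hom.ext rfl ?_ rfl
    exact div_id X
  map_comp ψ φ := by
    refine ElemFrobenioid.Hom.ext rfl ?_ rfl
    show div (ψ ≫ φ) = _
    rw [div_comp]
    rfl

/-- The structure functor lies over the base: `Base ∘ toElem = baseFunctor` on objects.
[cite: MochizukiFrdII2008, Ex 3.3 (i) p.28] -/
@[simp] theorem toElem_obj_base (X : C0) : (toElem.obj X).base = X.base := rfl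

/-- … and on arrows. [cite: MochizukiFrdII2008, Ex 3.3 (i) p.28] -/
@[simp] theorem toElem_map_base (φ : X ⟶ Y) : ElemFrobenioid.Base (toElem.map φ) = Base φ := rfl

/-- `Div` of the structure functor is `div`. [cite: MochizukiFrdII2008, Ex 3.3 (i) p.28] -/
@[simp] theorem toElem_map_div (φ : X ⟶ Y) : ElemFrobenioid.Div (toElem.map φ) = div φ := rfl

/-- `deg_Fr` of the structure functor is `degFr`. [cite: MochizukiFrdII2008, Ex 3.3 (i) p.28] -/
@[simp] theorem toElem_map_degFr (φ : X ⟶ Y) : ElemFrobenioid.degFr (toElem.map φ) = degFr φ := rfl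

/-! ### The printed claims about `C₀` (p. 28 l. 1) -/

/-- "One verifies immediately that this category `C₀` is … totally epimorphic" (FrdII Ex. 3.3 (i),
p. 28) — PROVED: cancel `Base` (total epimorphicity of `D₀`), `deg_Fr` (in `ℕ_{≥1}`) and the
scalar. [cite: MochizukiFrdII2008, Ex 3.3 (i) p.28] -/
theorem isTotallyEpimorphic : IsTotallyEpimorphic C0 := by
  refine ⟨fun {X Y} ψ => ⟨fun {Z} φ₁ φ₂ h => ?_⟩⟩
  have hb : Base ψ ≫ Base φ₁ = Base ψ ≫ Base φ₂ := congrArg Base h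
  have hd : degFr ψ * degFr φ₁ = degFr ψ * degFr φ₂ := congrArg degFr h
  have hs : (Base ψ).act (scalar φ₁) * scalar ψ ^ (degFr φ₁ : ℕ) =
      (Base ψ).act (scalar φ₂) * scalar ψ ^ (degFr φ₂ : ℕ) := congrArg scalar h
  haveI := D0.isTotallyEpimorphic.epi (Base ψ)
  have hd' : degFr φ₁ = degFr φ₂ := mul_left_cancel hd
  rw [hd'] at hs
  exact hom_ext ((cancel_epi (Base ψ)).mp hb) hd' ((Base ψ).act.injective (mul_right_cancel hs))

/-- "One verifies immediately that this category `C₀` is connected" (FrdII Ex. 3.3 (i), p. 28) —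
the statement. [cite: MochizukiFrdII2008, Ex 3.3 (i) p.28] -/
def IsConnectedStatement : Prop := IsGraphConnected C0

/-- "`C₀` is connected" — PROVED: every object maps to the real object of tip `1` (`toRealUnit`).
[cite: MochizukiFrdII2008, Ex 3.3 (i) p.28] -/
theorem isConnectedStatement_holds : IsConnectedStatement := by
  refine ⟨⟨realOfTip 1⟩, fun X Y => ?_⟩
  exact (Zigzag.of_hom (toRealUnit X)).trans (Zigzag.of_inv (toRealUnit Y))

/-- "the triple `(Base(−), Div(−), deg_Fr(−))` determines a *pre-Frobenioid structure*" in the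
sense of [FrdI] Def. 1.1 (iv) (divisorial monoid on a connected, totally epimorphic base; `C₀`
connected and totally epimorphic) — the statement, over found's `IsPreFrobenioid`
(FrdII Ex. 3.3 (i), p. 28). [cite: MochizukiFrdII2008, Ex 3.3 (i) p.28] -/
def PreFrobenioidStructure : Prop := IsPreFrobenioid Φ₀ toElem

/-- **`C₀ → F_{Φ₀}` is a pre-Frobenioid** ([FrdI] Def. 1.1 (iv)) — PROVED: `Φ₀` is a divisorial monoid
on the connected, totally epimorphic `D₀`, and `C₀` is connected and totally epimorphic.
[cite: MochizukiFrdII2008, Ex 3.3 (i) p.28] -/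
theorem preFrobenioidStructure_holds : PreFrobenioidStructure where
  isMonoidOn := isMonoidOn_Φ₀
  isDivisorial := isDivisorial_Φ₀
  isGraphConnected_base := D0.isGraphConnected
  isTotallyEpimorphic_base := D0.isTotallyEpimorphic
  isGraphConnected := isConnectedStatement_holds
  isTotallyEpimorphic := isTotallyEpimorphic

/-- "`Div(φ) := log(λ)` … for the **largest** `λ ∈ ℝ_{>0}` such that `λ · Im(A_L^{⊗d}) ⊆ A_K|_L`"
(FrdII Ex. 3.3 (i), p. 28): our `ratio φ` is that largest `λ` — named statement (the positive real
`λ` acts on `ℂ^×` through `ofPosReal`). [cite: MochizukiFrdII2008, Ex 3.3 (i) p.28] -/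
def DivIsLogLargest : Prop :=
  ∀ (X Y : C0) (φ : X ⟶ Y),
    IsGreatest {t : ℝ | 0 < t ∧ ∀ ht : 0 < t, ofPosReal ℂ ⟨t, ht⟩ • Hom.image φ ⊆ pullRegion Y (Base φ)}
      (ratio φ)

end C0

end ArchFrd

end

end Literature.AlgebraicGeometry.Frobenioids
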